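import Summits.Ventures.Crystal3D.Theorems.StickyWulffConstantNoReconstructionGainExactCriminalHeavy
import Mathlib.Analysis.SpecialFunctions.Complex.Arg
import Mathlib.Analysis.SpecialFunctions.Trigonometric.Bounds
import Mathlib.Analysis.Real.Pi.Bounds
import Mathlib.Analysis.InnerProductSpace.Projection.Reflection
import HarnessLib

/-!
# No criminal has a thin off-lattice part (line `replication-exactness`)

HONEST FRAMING. Part of the venture `Summits/Ventures/Crystal3D` (cell `crystal3d-full`), supports the
crux `NoReconstructionGain` (stmt-Ventures-19144, route `route-Ventures-StickyWulffConstant`), line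
`replication-exactness` (lead wulff-p1 g18).  Anatomy of minimal counterexamples to EXACT₀: by
`exists_offLattice_ten_contacts_of_criminal` (`…ExactCriminalHeavy`) a criminal contains an
off-lattice ball `q` with at least SEVEN off-lattice film partners.  If the off-lattice part of the
film were thin in some direction `e` — all its `e`-heights within `1/4` of each other — the seven
bond vectors `x − q` would be near-horizontal unit vectors pairwise (almost) a unit apart, and their
horizontal parts seven planar vectors of norm² `≥ 15/16` pairwise at distance² `≥ 15/16`; two of
seven planar directions are within the angle `2π/7`, `cos (2π/7) ≥ 0.59`, contradiction.  So the
off-lattice part of a criminal is at least `1/4` thick in EVERY direction: no buckled-monolayer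
criminal, on any face, in any orientation.

* `cos_two_pi_div_seven_ge`, `exists_cos_sub_ge` (seven angles: two within `2π/7` on the circle),
  `re_mul_add_im_mul`, `seven_planar_false` — planar pigeonhole;
* `seven_thin_unit_vectors_false` — seven unit vectors with `|⟪·,e⟫| ≤ 1/4`, pairwise `≥ 1` apart
  and with pairwise `e`-height differences `≤ 1/4`, do not exist;
* `not_isCriminal_of_thin_offLattice` — **no criminal whose off-lattice balls have `e`-heights
  within `1/4` of each other**, for any unit `e`, on any face;
* `not_isCriminal_of_locallyThin_offLattice` — the local form: it suffices that every off-lattice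
  ball with its off-lattice partners is `1/4`-thin in some direction of its own (no locally flat,
  possibly curved, off-lattice sheet is a criminal).

WHAT THIS IS NOT: the Euler-formula version (thickness `< 1/√2` via planarity of the lateral contact
graph) is not formalised; the crux is not moved; rung F-C1 not moved.
-/

noncomputable section

namespace Summit.Ventures.Crystal3D.Theorems

open Summit.Ventures.Crystal3D
open Literature.MathematicalPhysics.StatisticalMechanics (fccStacking)
open scoped InnerProductSpace Real
open Finset

/-! ## Planar pigeonhole -/

/-- `cos (2π/7) ≥ 59/100` (from `1 − x²/2 ≤ cos x` and `π < 3.15`). -/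
theorem cos_two_pi_div_seven_ge : (59 / 100 : ℝ) ≤ Real.cos (2 * π / 7) := by
  have h1 := Real.one_sub_sq_div_two_le_cos (x := 2 * π / 7)
  have hπ := Real.pi_lt_d2
  have hπ0 := Real.pi_pos
  have h2 : (2 * π / 7) ^ 2 ≤ (9 / 10) ^ 2 := by
    apply pow_le_pow_left₀ (by positivity)
    linarith
  linarith

/-- Among seven angles in `(-π, π]` two are within `2π/7` of each other on the circle. -/
theorem exists_cos_sub_ge (θ : Fin 7 → ℝ) (hlo : ∀ i, -π < θ i) (hhi : ∀ i, θ i ≤ π) :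
    ∃ i j, i ≠ j ∧ Real.cos (2 * π / 7) ≤ Real.cos (θ i - θ j) := by
  classical
  have hπ0 := Real.pi_pos
  set ℓ : ℝ := 2 * π / 7 with hℓ
  have hℓ0 : 0 < ℓ := by rw [hℓ]; positivity
  -- close pairs are fine
  have hclose : ∀ i j, |θ i - θ j| ≤ ℓ → Real.cos ℓ ≤ Real.cos (θ i - θ j) := by
    intro i j h
    rw [← Real.cos_abs (θ i - θ j)]
    exact Real.cos_le_cos_of_nonneg_of_le_pi (abs_nonneg _) (by rw [hℓ]; linarith) h
  -- far pairs (gap ≥ 2π − ℓ) are fine too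
  have hfar : ∀ i j, 2 * π - ℓ ≤ θ i - θ j → Real.cos ℓ ≤ Real.cos (θ i - θ j) := by
    intro i j h
    have h2 : θ i - θ j < 2 * π := by linarith [hlo j, hhi i]
    rw [← Real.cos_two_pi_sub (θ i - θ j)]
    exact Real.cos_le_cos_of_nonneg_of_le_pi (by linarith) (by rw [hℓ]; linarith) (by linarith)
  -- the lowest angle
  obtain ⟨i₀, -, hmin⟩ := Finset.exists_min_image Finset.univ θ Finset.univ_nonempty
  by_cases hex : ∃ j, j ≠ i₀ ∧ (θ j - θ i₀ < ℓ ∨ 2 * π - ℓ ≤ θ j - θ i₀)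
  · obtain ⟨j, hj, h⟩ := hex
    rcases h with h | h
    · refine ⟨j, i₀, hj, hclose j i₀ ?_⟩
      rw [abs_le]; constructor <;> linarith [hmin j (Finset.mem_univ j)]
    · exact ⟨j, i₀, hj, hfar j i₀ h⟩
  · push Not at hex
    -- the six others fall into the five bins `1, …, 5`
    set f : Fin 7 → ℕ := fun j => ⌊(θ j - θ i₀) / ℓ⌋₊ with hf
    have hmaps : ∀ j ∈ Finset.univ.erase i₀, f j ∈ Finset.Icc 1 5 := by
      intro j hj
      obtain ⟨h1, h2⟩ := hex j (Finset.ne_of_mem_erase hj)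
      have hd0 : 0 ≤ (θ j - θ i₀) / ℓ := div_nonneg (by linarith [hmin j (Finset.mem_univ j)]) hℓ0.le
      rw [Finset.mem_Icc, hf]
      constructor
      · rw [Nat.one_le_floor_iff, le_div_iff₀ hℓ0]; linarith
      · rw [← Nat.lt_succ_iff, Nat.floor_lt hd0, div_lt_iff₀ hℓ0]
        push_cast
        have : 2 * π = 7 * ℓ := by rw [hℓ]; ring
        linarith
    have hcard : (Finset.Icc 1 5).card < (Finset.univ.erase i₀).card := by
      rw [Finset.card_erase_of_mem (Finset.mem_univ _), Finset.card_univ, Fintype.card_fin]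
      simp
    obtain ⟨j, hj, j', hj', hne, hjj⟩ := Finset.exists_ne_map_eq_of_card_lt_of_maps_to hcard hmaps
    refine ⟨j, j', hne, hclose j j' ?_⟩
    have hdj : 0 ≤ (θ j - θ i₀) / ℓ := div_nonneg (by linarith [hmin j (Finset.mem_univ j)]) hℓ0.le
    have hdj' : 0 ≤ (θ j' - θ i₀) / ℓ := div_nonneg (by linarith [hmin j' (Finset.mem_univ j')]) hℓ0.le
    have h1 : ((f j : ℕ) : ℝ) ≤ (θ j - θ i₀) / ℓ := Nat.floor_le hdj
    have h2 : (θ j - θ i₀) / ℓ < ((f j : ℕ) : ℝ) + 1 := Nat.lt_floor_add_one _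
    have h3 : ((f j' : ℕ) : ℝ) ≤ (θ j' - θ i₀) / ℓ := Nat.floor_le hdj'
    have h4 : (θ j' - θ i₀) / ℓ < ((f j' : ℕ) : ℝ) + 1 := Nat.lt_floor_add_one _
    have h5 : ((f j : ℕ) : ℝ) = ((f j' : ℕ) : ℝ) := by exact_mod_cast hjj
    have e1 : θ j - θ j' = ((θ j - θ i₀) / ℓ - (θ j' - θ i₀) / ℓ) * ℓ := by
      field_simp
      ring
    have hlt : |(θ j - θ i₀) / ℓ - (θ j' - θ i₀) / ℓ| ≤ 1 := by
      rw [abs_le]; constructor <;> linarith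
    rw [e1, abs_mul, abs_of_pos hℓ0]
    calc |(θ j - θ i₀) / ℓ - (θ j' - θ i₀) / ℓ| * ℓ ≤ 1 * ℓ := mul_le_mul_of_nonneg_right hlt hℓ0.le
      _ = ℓ := one_mul ℓ

/-- `Re (z w̄)` in polar form. -/
theorem re_mul_add_im_mul (z w : ℂ) (hz : z ≠ 0) (hw : w ≠ 0) :
    z.re * w.re + z.im * w.im = ‖z‖ * ‖w‖ * Real.cos (Complex.arg z - Complex.arg w) := by
  rw [Real.cos_sub, Complex.cos_arg hz, Complex.cos_arg hw, Complex.sin_arg, Complex.sin_arg]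
  have hz' : ‖z‖ ≠ 0 := norm_ne_zero_iff.2 hz
  have hw' : ‖w‖ ≠ 0 := norm_ne_zero_iff.2 hw
  field_simp

/-- Seven planar vectors of norm² in `[15/16, 1]` are not pairwise at distance² `≥ 15/16`. -/
theorem seven_planar_false (z : Fin 7 → ℂ) (hlo : ∀ i, 15 / 16 ≤ ‖z i‖ ^ 2) (hhi : ∀ i, ‖z i‖ ^ 2 ≤ 1)
    (hsep : ∀ i j, i ≠ j → 15 / 16 ≤ ‖z i - z j‖ ^ 2) : False := by
  have hne : ∀ i, z i ≠ 0 := by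
    intro i h
    have := hlo i
    rw [h, norm_zero] at this
    norm_num at this
  obtain ⟨i, j, hij, hcos⟩ := exists_cos_sub_ge (fun i => Complex.arg (z i))
    (fun i => Complex.neg_pi_lt_arg _) (fun i => Complex.arg_le_pi _)
  have hc := cos_two_pi_div_seven_ge
  have hre := re_mul_add_im_mul (z i) (z j) (hne i) (hne j)
  have hexp : ‖z i - z j‖ ^ 2 = ‖z i‖ ^ 2 + ‖z j‖ ^ 2 - 2 * ((z i).re * (z j).re + (z i).im * (z j).im) := by
    rw [Complex.sq_norm, Complex.sq_norm, Complex.sq_norm, Complex.normSq_apply, Complex.normSq_apply,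
      Complex.normSq_apply, Complex.sub_re, Complex.sub_im]
    ring
  have hn0 : 0 ≤ ‖z i‖ := norm_nonneg _
  have hn1 : 0 ≤ ‖z j‖ := norm_nonneg _
  have hprod : 15 / 16 ≤ ‖z i‖ * ‖z j‖ := by
    have h1 : (15 / 16 : ℝ) ^ 2 ≤ (‖z i‖ * ‖z j‖) ^ 2 := by
      rw [mul_pow]; nlinarith [hlo i, hlo j]
    nlinarith [h1, mul_nonneg hn0 hn1]
  have hcos' : 59 / 100 ≤ Real.cos (Complex.arg (z i) - Complex.arg (z j)) := hc.trans hcos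
  have key : (15 / 16 : ℝ) * (59 / 100) ≤ ‖z i‖ * ‖z j‖ * Real.cos (Complex.arg (z i) - Complex.arg (z j)) :=
    mul_le_mul hprod hcos' (by norm_num) (mul_nonneg hn0 hn1)
  have := hsep i j hij
  rw [hexp, hre] at this
  linarith [hhi i, hhi j]


/-! ## Seven thin unit vectors -/

/-- **Seven near-horizontal unit vectors pairwise a unit apart do not exist.** -/
theorem seven_thin_unit_vectors_false (e : EuclideanSpace ℝ (Fin 3)) (he : ‖e‖ = 1)
    (w : Fin 7 → EuclideanSpace ℝ (Fin 3)) (hw1 : ∀ i, ‖w i‖ = 1) (hwe : ∀ i, |⟪w i, e⟫_ℝ| ≤ 1 / 4)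
    (hsep : ∀ i j, i ≠ j → 1 ≤ ‖w i - w j‖) (hthin : ∀ i j, |⟪w i - w j, e⟫_ℝ| ≤ 1 / 4) : False := by
  -- rotate `e` to the third axis
  set e₃ : EuclideanSpace ℝ (Fin 3) := EuclideanSpace.single 2 1 with he₃def
  have he₃ : ‖e₃‖ = 1 := by rw [he₃def, PiLp.norm_single, norm_one]
  have hin3 : ∀ v : EuclideanSpace ℝ (Fin 3), ⟪v, e₃⟫_ℝ = v 2 := by
    intro v; rw [he₃def, EuclideanSpace.inner_single_right]; simp
  set A := (ℝ ∙ (e - e₃))ᗮ.reflection with hA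
  have hAe : A e = e₃ := by rw [hA]; exact Submodule.reflection_sub (by rw [he, he₃])
  set a : Fin 7 → EuclideanSpace ℝ (Fin 3) := fun i => A (w i) with ha
  have ha2 : ∀ i, a i 2 = ⟪w i, e⟫_ℝ := by
    intro i; rw [← hin3, ha, ← hAe, LinearIsometryEquiv.inner_map_map]
  have hasub : ∀ i j, a i - a j = A (w i - w j) := by intro i j; rw [ha, map_sub]
  have ha2' : ∀ i j, (a i - a j) 2 = ⟪w i - w j, e⟫_ℝ := by
    intro i j; rw [← hin3, hasub, ← hAe, LinearIsometryEquiv.inner_map_map]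
  have hna : ∀ i, ‖a i‖ = 1 := by intro i; rw [ha, LinearIsometryEquiv.norm_map, hw1]
  have hna' : ∀ i j, ‖a i - a j‖ = ‖w i - w j‖ := by
    intro i j; rw [hasub, LinearIsometryEquiv.norm_map]
  have hsq : ∀ v : EuclideanSpace ℝ (Fin 3), ‖v‖ ^ 2 = v 0 ^ 2 + v 1 ^ 2 + v 2 ^ 2 := by
    intro v; rw [EuclideanSpace.real_norm_sq_eq, Fin.sum_univ_three]
  -- the horizontal parts as complex numbers
  set z : Fin 7 → ℂ := fun i => ⟨a i 0, a i 1⟩ with hz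
  have hzn : ∀ i, ‖z i‖ ^ 2 = 1 - ⟪w i, e⟫_ℝ ^ 2 := by
    intro i
    rw [Complex.sq_norm, hz, Complex.normSq_mk, ← ha2 i]
    have := hsq (a i); rw [hna i, one_pow] at this
    nlinarith [this]
  have hzd : ∀ i j, ‖z i - z j‖ ^ 2 = ‖w i - w j‖ ^ 2 - ⟪w i - w j, e⟫_ℝ ^ 2 := by
    intro i j
    have e1 : z i - z j = ⟨(a i - a j) 0, (a i - a j) 1⟩ := by
      rw [hz]; apply Complex.ext <;> simp
    rw [Complex.sq_norm, e1, Complex.normSq_mk, ← ha2' i j, ← hna' i j]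
    have := hsq (a i - a j)
    nlinarith [this]
  refine seven_planar_false z (fun i => ?_) (fun i => ?_) (fun i j hij => ?_)
  · rw [hzn]
    have h := hwe i; rw [abs_le] at h
    nlinarith [h.1, h.2]
  · rw [hzn]; nlinarith [sq_nonneg ⟪w i, e⟫_ℝ]
  · rw [hzd]
    have h := hthin i j; rw [abs_le] at h
    have h1 := hsep i j hij
    have h2 : 1 ≤ ‖w i - w j‖ ^ 2 := by nlinarith [h1]
    nlinarith [h.1, h.2, h2]

/-! ## No thin criminal -/

open scoped Classical in
/-- **No criminal has a thin off-lattice part.**  If for some unit vector `e` the off-lattice balls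
of a film on `H(ν,s)` have `e`-heights within `1/4` of each other, the film is not a criminal. -/
theorem not_isCriminal_of_thin_offLattice {ν : EuclideanSpace ℝ (Fin 3)} {s : ℝ}
    {Q : Finset (EuclideanSpace ℝ (Fin 3))} (e : EuclideanSpace ℝ (Fin 3)) (he : ‖e‖ = 1)
    (hthin : ∀ x ∈ Q, ∀ y ∈ Q, x ∉ fccStacking 1 (Real.sqrt (2 / 3)) →
      y ∉ fccStacking 1 (Real.sqrt (2 / 3)) → |⟪x - y, e⟫_ℝ| ≤ 1 / 4) :
    ¬ IsCriminal ν s Q := by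
  intro hcrim
  obtain ⟨q, hq, hqΛ, -, -, h7⟩ := exists_offLattice_ten_contacts_of_criminal hcrim
  obtain ⟨T, hT, hTc⟩ := Finset.exists_subset_card_eq h7
  set g := (T.equivFinOfCardEq hTc).symm with hg
  have hmem : ∀ i, ((g i : EuclideanSpace ℝ (Fin 3)) ∈ Q ∧
      (g i : EuclideanSpace ℝ (Fin 3)) ∉ fccStacking 1 (Real.sqrt (2 / 3)) ∧
      dist q (g i) = 1) := by
    intro i
    have h := hT (g i).2
    rw [Finset.mem_filter] at h
    exact ⟨h.1, h.2.1, h.2.2⟩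
  refine seven_thin_unit_vectors_false e he (fun i => (g i : EuclideanSpace ℝ (Fin 3)) - q)
    (fun i => ?_) (fun i => hthin _ (hmem i).1 q hq (hmem i).2.1 hqΛ) (fun i j hij => ?_)
    (fun i j => ?_)
  · rw [← dist_eq_norm, dist_comm]; exact (hmem i).2.2
  · have hne : (g i : EuclideanSpace ℝ (Fin 3)) ≠ g j := fun h =>
      hij (g.injective (Subtype.ext h))
    have e1 : (g i : EuclideanSpace ℝ (Fin 3)) - q - ((g j : EuclideanSpace ℝ (Fin 3)) - q) =
        (g i : EuclideanSpace ℝ (Fin 3)) - g j := by abel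
    rw [e1, ← dist_eq_norm]
    exact hcrim.1.1 _ (hmem i).1 _ (hmem j).1 hne
  · have e1 : (g i : EuclideanSpace ℝ (Fin 3)) - q - ((g j : EuclideanSpace ℝ (Fin 3)) - q) =
        (g i : EuclideanSpace ℝ (Fin 3)) - g j := by abel
    rw [e1]
    exact hthin _ (hmem i).1 _ (hmem j).1 (hmem i).2.1 (hmem j).2.1

open scoped Classical in
/-- **No criminal is locally thin.**  If every off-lattice ball `q` of a film on `H(ν,s)` admits a
unit vector `e` (depending on `q`) such that `q` and its off-lattice film partners have `e`-heights
within `1/4` of each other — a locally flat, possibly curved, sheet of off-lattice balls over an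
arbitrary registry part — the film is not a criminal, on any face. -/
theorem not_isCriminal_of_locallyThin_offLattice {ν : EuclideanSpace ℝ (Fin 3)} {s : ℝ}
    {Q : Finset (EuclideanSpace ℝ (Fin 3))}
    (hthin : ∀ q ∈ Q, q ∉ fccStacking 1 (Real.sqrt (2 / 3)) →
      ∃ e : EuclideanSpace ℝ (Fin 3), ‖e‖ = 1 ∧
        ∀ x ∈ Q, ∀ y ∈ Q, x ∉ fccStacking 1 (Real.sqrt (2 / 3)) → y ∉ fccStacking 1 (Real.sqrt (2 / 3)) →
          (x = q ∨ dist q x = 1) → (y = q ∨ dist q y = 1) → |⟪x - y, e⟫_ℝ| ≤ 1 / 4) :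
    ¬ IsCriminal ν s Q := by
  intro hcrim
  obtain ⟨q, hq, hqΛ, -, -, h7⟩ := exists_offLattice_ten_contacts_of_criminal hcrim
  obtain ⟨e, he, hth⟩ := hthin q hq hqΛ
  obtain ⟨T, hT, hTc⟩ := Finset.exists_subset_card_eq h7
  set g := (T.equivFinOfCardEq hTc).symm with hg
  have hmem : ∀ i, ((g i : EuclideanSpace ℝ (Fin 3)) ∈ Q ∧
      (g i : EuclideanSpace ℝ (Fin 3)) ∉ fccStacking 1 (Real.sqrt (2 / 3)) ∧
      dist q (g i) = 1) := by
    intro i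
    have h := hT (g i).2
    rw [Finset.mem_filter] at h
    exact ⟨h.1, h.2.1, h.2.2⟩
  refine seven_thin_unit_vectors_false e he (fun i => (g i : EuclideanSpace ℝ (Fin 3)) - q)
    (fun i => ?_)
    (fun i => hth _ (hmem i).1 q hq (hmem i).2.1 hqΛ (Or.inr (hmem i).2.2) (Or.inl rfl))
    (fun i j hij => ?_) (fun i j => ?_)
  · rw [← dist_eq_norm, dist_comm]; exact (hmem i).2.2
  · have hne : (g i : EuclideanSpace ℝ (Fin 3)) ≠ g j := fun h =>
      hij (g.injective (Subtype.ext h))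
    have e1 : (g i : EuclideanSpace ℝ (Fin 3)) - q - ((g j : EuclideanSpace ℝ (Fin 3)) - q) =
        (g i : EuclideanSpace ℝ (Fin 3)) - g j := by abel
    rw [e1, ← dist_eq_norm]
    exact hcrim.1.1 _ (hmem i).1 _ (hmem j).1 hne
  · have e1 : (g i : EuclideanSpace ℝ (Fin 3)) - q - ((g j : EuclideanSpace ℝ (Fin 3)) - q) =
        (g i : EuclideanSpace ℝ (Fin 3)) - g j := by abel
    rw [e1]
    exact hth _ (hmem i).1 _ (hmem j).1 (hmem i).2.1 (hmem j).2.1 (Or.inr (hmem i).2.2)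
      (Or.inr (hmem j).2.2)

end Summit.Ventures.Crystal3D.Theorems

end
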